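import Literature.AlgebraicGeometry.Resolution.HenselizationDensity
import Literature.AlgebraicGeometry.Resolution.HenselizedRationalTameExtensions
import Literature.AlgebraicGeometry.Resolution.KnafKuhlmann2009Lemma21
import Mathlib.Algebra.Polynomial.Laurent
import HarnessLib

/-!
# `K[x,x⁻¹]` is dense in `K(x)^h` for a value-transcendental `x` of rank one (Kuhlmann 2010, Lemma 4.4) — proof

Topic: `Literature/AlgebraicGeometry/Resolution` (valued function fields). F.-V. Kuhlmann,
*Elimination of ramification I: The generalized stability theorem*, Trans. AMS 362 (2010)
5697–5727 = arXiv:1003.5678, §4.1, **Lemma 4.4**: "Let `F = K(x)^h` where `(K(x),v)` is of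
rank 1 and `x` is value-transcendental over `K`. Then `R [= K[x,x⁻¹]]` is dense in `F`."
Printed proof: "Since `(K(x),v)` is of rank 1, we know from Lemma 2.4 that it is dense in
`K(x)^h`. Now it suffices to prove that `R` is dense in its quotient field `K(x)`. For this, it
is enough to show that for every `0 ≠ φ(x) ∈ R` and `α ∈ vK(x)` there is some `φ̃(x) ∈ R` such
that `v(1/φ(x) - φ̃(x)) > α`. … `vφ(x) = min_{i∈I} vcᵢxⁱ = vc_k x^k` for a unique `k ∈ I` since
`x` is value-transcendental over `K`. We write `1/φ(x) = c_k⁻¹x⁻ᵏ/(1 - ψ(x))` with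
`ψ(x) = 1 - c_k⁻¹x⁻ᵏφ(x) ∈ R`. Since `vψ(x) > 0` and `vK` is archimedean by hypothesis, there
is some `n ∈ ℕ` such that `(n+1)vψ(x) > α + vc_kx^k`. Then by the geometric expansion, the
element `φ̃(x) := c_k⁻¹x⁻ᵏ ∑_{i=0}^{n} ψ(x)ⁱ ∈ R` satisfies
`v(1/φ(x) - φ̃(x)) = (n+1)vψ(x) - vc_kx^k > α`."

This is the second ingredient (after `HenselizationDensity.lean` = Lemma 2.4) of the
Artin–Schreier and Kummer normal forms of §4.1 (Props. 4.5–4.6), hence of Cor. 4.2 in the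
value-transcendental case (`Kuhlmann2010GaloisDegreePDefectlessVT`, `NormalDegreePDefectlessVT.lean`).

## Content (everything PROVED)

Ambient rendering (`GeneralizedStabilityHenselizedRational.lean`): one valued field `(Ω, V)`,
`K ≤ Ω` a subfield, `x ∈ Ω^×` value-transcendental over `K` (`IsValueTranscendentalOver`),
`K(x)^h = henselizedAdjoin V K x`, rank one = `IsRankOneValued`. The ring `R = K[x,x⁻¹]` is
rendered by its parametrization: the finite Laurent series are the values
`LaurentPolynomial.eval₂ (algebraMap K Ω) x r` of Mathlib's Laurent polynomials `r : K[T;T⁻¹]`.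

* `IsRankOneValued.exists_forall_lt_mul_pow`, `IsRankOneValued.exists_forall_mul_pow_lt`,
  `IsRankOneValued.archimedean_of_isAlgebraic` — archimedean bookkeeping for a rank-one
  subfield `F ≤ Ω` and for the elements algebraic over it (their values are torsion modulo
  `vF`, `exists_valuation_pow_eq_of_isAlgebraic`).
* `laurent_eval₂_eq_sum` (`r(x) = ∑ cᵢ xⁱ`), `IsValueTranscendentalOver.valuation_mul_zpow_ne`
  (the monomials `cᵢ xⁱ` have pairwise distinct values), `exists_valuation_laurent_eq` ("the
  value of the polynomial is equal to the least of the values of its monomials", Lemma 2.5),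
  `laurent_eval₂_ne_zero`, `valuation_laurent_lt`, `valuation_monomial_le_valuation_laurent`,
  `laurent_eval₂_mem_adjoin`.
* `exists_laurent_valuation_inv_sub_lt` — the geometric-series step of Lemma 4.4: `1/φ(x)` is
  approximated by elements of `R`.
* `exists_laurent_valuation_sub_lt_of_mem_adjoin` — **`R` is dense in `K(x)`** (rank one).
* `exists_valuation_eq_of_mem_henselizedAdjoin` (`vK(x)^h = vK ⊕ ℤvx`),
  `resField_henselizedAdjoin_le` (`K(x)^h v = Kv`) — §4, (4.2): "In this case, `F̄ = K̄` and
  `vF = vK ⊕ ℤvx`" (Lemma 2.2 + Lemma 2.5, both PROVED in the tree).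
* `exists_laurent_valuation_sub_lt` — **Lemma 4.4: `R` is dense in `F = K(x)^h`** for `F` of
  rank one, from Lemma 2.4 (`exists_mem_valuation_sub_lt_of_mem_henselization_of_archimedean`).

## Sources

* F.-V. Kuhlmann, *Elimination of ramification I*, Trans. AMS 362 (2010) = arXiv:1003.5678,
  Lemma 2.4, Lemma 2.5, §4 (4.2), Lemma 4.4 (p. 12). [Kuhlmann2010]

No definition is introduced.
-/

noncomputable section

open IsLocalRing LaurentPolynomial

namespace Literature.AlgebraicGeometry.Resolution

universe u

variable {Ω : Type u} [Field Ω] (V : ValuationSubring Ω)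

/-! ### Archimedean bookkeeping for a rank-one subfield -/

section RankOne

variable {V}

/-- In a rank-one subfield `F`: for `t ∈ F` with `|t| > 1` and `A, B ∈ F`, `B ≠ 0`,
`|A| < |B|·|t|ⁿ` for all large `n`. [folklore] -/
theorem IsRankOneValued.exists_forall_lt_mul_pow {F : Subfield Ω} (hF : IsRankOneValued V F)
    {t : Ω} (htF : t ∈ F) (ht : 1 < V.valuation t) {A B : Ω} (hA : A ∈ F) (hB : B ∈ F)
    (hB0 : B ≠ 0) :
    ∃ n₀ : ℕ, ∀ n, n₀ ≤ n → V.valuation A < V.valuation B * V.valuation t ^ n := by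
  obtain ⟨n, hn⟩ := hF.2 t htF (A / B) (div_mem hA hB) ht
  have hBv : 0 < V.valuation B := (Valuation.pos_iff _).mpr hB0
  refine ⟨n + 1, fun m hm => ?_⟩
  have hA' : V.valuation A = V.valuation (A / B) * V.valuation B := by
    rw [map_div₀, div_mul_cancel₀ _ hBv.ne']
  rw [hA', mul_comm]
  gcongr
  calc V.valuation (A / B) ≤ V.valuation t ^ n := hn
    _ < V.valuation t ^ m := pow_lt_pow_right₀ ht (by omega)

/-- In a rank-one subfield `F`: for `t ∈ F` with `|t| < 1` and `A, B ∈ F`, `B ≠ 0`,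
`|A|·|t|ⁿ < |B|` for all large `n`. [folklore] -/
theorem IsRankOneValued.exists_forall_mul_pow_lt {F : Subfield Ω} (hF : IsRankOneValued V F)
    {t : Ω} (htF : t ∈ F) (ht : V.valuation t < 1) {A B : Ω} (hA : A ∈ F) (hB : B ∈ F)
    (hB0 : B ≠ 0) :
    ∃ n₀ : ℕ, ∀ n, n₀ ≤ n → V.valuation A * V.valuation t ^ n < V.valuation B := by
  have hBv : 0 < V.valuation B := (Valuation.pos_iff _).mpr hB0
  by_cases ht0 : V.valuation t = 0
  · refine ⟨1, fun n hn => ?_⟩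
    rw [ht0, zero_pow (by omega), mul_zero]
    exact hBv
  · have htpos : 0 < V.valuation t := zero_lt_iff.mpr ht0
    have hti : 1 < V.valuation t⁻¹ := by
      rw [map_inv₀]
      exact one_lt_inv_iff₀.mpr ⟨htpos, ht⟩
    obtain ⟨n₀, hn₀⟩ := hF.exists_forall_lt_mul_pow (F.inv_mem htF) hti hA hB hB0
    refine ⟨n₀, fun n hn => ?_⟩
    have h := hn₀ n hn
    rw [map_inv₀, inv_pow] at h
    have hpow : 0 < V.valuation t ^ n := pow_pos htpos n
    calc V.valuation A * V.valuation t ^ n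
        < V.valuation B * (V.valuation t ^ n)⁻¹ * V.valuation t ^ n := by gcongr
      _ = V.valuation B := by rw [mul_assoc, inv_mul_cancel₀ hpow.ne', mul_one]

/-- **Rank one passes to the elements algebraic over `F`** (Kuhlmann 2010, Lemma 2.1: "`vL/vK`
is a torsion group"; §2.1: rank one iff archimedean): if `(F, v)` has rank one and `y, z` are
algebraic over `F` with `|y| > 1`, then `|z| ≤ |y|ⁿ` for some `n`. PROVED: some powers
`|y|^k`, `|z|^{k'}` (`k, k' ≥ 1`) are values of `F` (`exists_valuation_pow_eq_of_isAlgebraic`).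
[cite: Kuhlmann2010, Lemma 2.1] -/
theorem IsRankOneValued.archimedean_of_isAlgebraic {F : Subfield Ω} (hF : IsRankOneValued V F)
    {y z : Ω} (hy : IsAlgebraic F y) (hz : IsAlgebraic F z) (h1 : 1 < V.valuation y) :
    ∃ n : ℕ, V.valuation z ≤ V.valuation y ^ n := by
  have hy0 : y ≠ 0 := fun h => by
    rw [h, map_zero] at h1
    exact not_lt_zero h1
  by_cases hz0 : z = 0
  · exact ⟨0, by rw [hz0, map_zero]; exact zero_le⟩
  obtain ⟨k, hk, e₁, he₁F, hke₁⟩ := exists_valuation_pow_eq_of_isAlgebraic V hy hy0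
  obtain ⟨k', hk', e₂, he₂F, hke₂⟩ := exists_valuation_pow_eq_of_isAlgebraic V hz hz0
  rw [map_pow] at hke₁ hke₂
  have he₁ : 1 < V.valuation e₁ := by
    rw [← hke₁]
    exact one_lt_pow₀ h1 hk
  obtain ⟨n, hn⟩ := hF.2 e₁ he₁F e₂ he₂F he₁
  refine ⟨k * n, ?_⟩
  rw [pow_mul, hke₁]
  -- `|z|^{k'} = |e₂| ≤ |e₁|^n`, and `|z| ≤ |z|^{k'}` unless `|z| ≤ 1 ≤ |e₁|^n`
  rcases le_or_gt (V.valuation z) 1 with hz1 | hz1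
  · exact hz1.trans (one_le_pow₀ he₁.le)
  · calc V.valuation z ≤ V.valuation z ^ k' := le_self_pow₀ hz1.le hk'
      _ = V.valuation e₂ := hke₂
      _ ≤ V.valuation e₁ ^ n := hn

end RankOne

/-! ### Finite Laurent series in a value-transcendental element -/

section Laurent

variable {V} {K : Subfield Ω}

/-- The monomials `c xⁱ`, `d xʲ` (`c, d ∈ K^×`, `i ≠ j`) have distinct values when `x` is
value-transcendental over `K`. [folklore] -/
theorem IsValueTranscendentalOver.valuation_mul_zpow_ne {x : Ω}
    (hx : IsValueTranscendentalOver V K x) {c d : Ω} (hc : c ∈ K) (hd : d ∈ K) (hc0 : c ≠ 0)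
    {i j : ℤ} (hij : i ≠ j) :
    V.valuation (c * x ^ i) ≠ V.valuation (d * x ^ j) := by
  intro h
  have hx0 : V.valuation x ≠ 0 := (map_ne_zero _).mpr hx.ne_zero
  have hvc : V.valuation c ≠ 0 := (map_ne_zero _).mpr hc0
  rw [map_mul, map_mul, map_zpow₀, map_zpow₀] at h
  have key : V.valuation x ^ (i - j) = V.valuation (d / c) := by
    rw [zpow_sub₀ hx0, map_div₀, div_eq_div_iff (zpow_ne_zero _ hx0) hvc]
    calc V.valuation x ^ i * V.valuation c = V.valuation c * V.valuation x ^ i := mul_comm _ _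
      _ = V.valuation d * V.valuation x ^ j := h
  exact hx.zpow_ne (sub_ne_zero.mpr hij) (div_mem hd hc) key

variable (x : Ωˣ)

/-- A Laurent polynomial evaluates to the finite Laurent series of its coefficients:
`r(x) = ∑_{i ∈ supp r} rᵢ xⁱ`. [folklore] -/
theorem laurent_eval₂_eq_sum (r : LaurentPolynomial K) :
    LaurentPolynomial.eval₂ (algebraMap K Ω) x r =
      ∑ i ∈ r.coeff.support, ((r.coeff i : K) : Ω) * (x : Ω) ^ i := by
  conv_lhs => rw [← AddMonoidAlgebra.sum_coeff_single r]
  rw [Finsupp.sum, map_sum]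
  refine Finset.sum_congr rfl fun i _ => ?_
  rw [LaurentPolynomial.single_eq_C_mul_T, LaurentPolynomial.eval₂_C_mul_T,
    Units.val_zpow_eq_zpow_val]
  rfl

/-- Finite Laurent series in `x` over `K` lie in `K(x)`. [folklore] -/
theorem laurent_eval₂_mem_adjoin (r : LaurentPolynomial K) :
    LaurentPolynomial.eval₂ (algebraMap K Ω) x r ∈
      (IntermediateField.adjoin K ({(x : Ω)} : Set Ω)).toSubfield := by
  rw [laurent_eval₂_eq_sum]
  refine Subfield.sum_mem _ fun i _ => Subfield.mul_mem _ ?_ (Subfield.zpow_mem _ ?_ i)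
  · exact (IntermediateField.adjoin K ({(x : Ω)} : Set Ω)).algebraMap_mem (r.coeff i)
  · exact IntermediateField.subset_adjoin K ({(x : Ω)} : Set Ω) rfl

variable {x}

/-- **Kuhlmann 2010, Lemma 2.5 for finite Laurent series** ("the value of the polynomial `f` is
equal to the least of the values of its monomials"; Lemma 4.4: "`vφ(x) = min_{i∈I} vcᵢxⁱ = vc_kx^k`
for a unique `k ∈ I` since `x` is value-transcendental over `K`"): for `r ≠ 0` there is an
exponent `k` in the support with `|r(x)| = |r_k x^k| ≥ |rᵢ xⁱ|` for all `i`. PROVED.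
[cite: Kuhlmann2010, Lemma 2.5] -/
theorem exists_valuation_laurent_eq (hx : IsValueTranscendentalOver V K x) {r : LaurentPolynomial K}
    (hr : r ≠ 0) :
    ∃ k ∈ r.coeff.support,
      V.valuation (LaurentPolynomial.eval₂ (algebraMap K Ω) x r) =
          V.valuation (((r.coeff k : K) : Ω) * (x : Ω) ^ k) ∧
        ∀ i ∈ r.coeff.support,
          V.valuation (((r.coeff i : K) : Ω) * (x : Ω) ^ i) ≤
            V.valuation (((r.coeff k : K) : Ω) * (x : Ω) ^ k) := by
  classical
  have hsupp : r.coeff.support.Nonempty := by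
    rw [Finsupp.support_nonempty_iff, Ne, AddMonoidAlgebra.coeff_eq_zero]
    exact hr
  have hinj : Set.InjOn (fun i => V.valuation (((r.coeff i : K) : Ω) * (x : Ω) ^ i))
      r.coeff.support := by
    intro i hi j hj h
    by_contra hij
    have hi0 : ((r.coeff i : K) : Ω) ≠ 0 := fun h0 =>
      (Finsupp.mem_support_iff.mp hi) (Subtype.ext h0)
    exact hx.valuation_mul_zpow_ne (r.coeff i).2 (r.coeff j).2 hi0 hij h
  obtain ⟨k, hk, hsum, hle⟩ := exists_valuation_sum_eq V r.coeff.support hsupp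
    (fun i => ((r.coeff i : K) : Ω) * (x : Ω) ^ i) hinj
  refine ⟨k, hk, ?_, hle⟩
  rw [laurent_eval₂_eq_sum]
  exact hsum

/-- Each monomial is bounded by the value of the series: `|rᵢ xⁱ| ≤ |r(x)|`. [folklore] -/
theorem valuation_monomial_le_valuation_laurent (hx : IsValueTranscendentalOver V K x)
    {r : LaurentPolynomial K} {i : ℤ} (hi : i ∈ r.coeff.support) :
    V.valuation (((r.coeff i : K) : Ω) * (x : Ω) ^ i) ≤
      V.valuation (LaurentPolynomial.eval₂ (algebraMap K Ω) x r) := by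
  have hr : r ≠ 0 := by
    rintro rfl
    simp at hi
  obtain ⟨k, -, heq, hle⟩ := exists_valuation_laurent_eq hx hr
  rw [heq]
  exact hle i hi

/-- A non-zero Laurent polynomial does not vanish at a value-transcendental `x`
(`x` is transcendental, Lemma 2.5). [cite: Kuhlmann2010, Lemma 2.5] -/
theorem laurent_eval₂_ne_zero (hx : IsValueTranscendentalOver V K x) {r : LaurentPolynomial K}
    (hr : r ≠ 0) : LaurentPolynomial.eval₂ (algebraMap K Ω) x r ≠ 0 := by
  obtain ⟨k, hk, heq, -⟩ := exists_valuation_laurent_eq hx hr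
  intro h0
  rw [h0, map_zero] at heq
  have hk0 : ((r.coeff k : K) : Ω) ≠ 0 := fun h0 =>
    (Finsupp.mem_support_iff.mp hk) (Subtype.ext h0)
  exact mul_ne_zero hk0 (zpow_ne_zero _ x.ne_zero) ((map_eq_zero _).mp heq.symm)

/-- If every monomial has value `< γ` (`γ ≠ 0`), so does the series. [folklore] -/
theorem valuation_laurent_lt {r : LaurentPolynomial K} {γ : ValuationSubring.ValueGroup V}
    (hγ : γ ≠ 0)
    (h : ∀ i ∈ r.coeff.support, V.valuation (((r.coeff i : K) : Ω) * (x : Ω) ^ i) < γ) :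
    V.valuation (LaurentPolynomial.eval₂ (algebraMap K Ω) x r) < γ := by
  rw [laurent_eval₂_eq_sum]
  exact Valuation.map_sum_lt _ hγ h

/-- If the series has value `< γ`, so does every monomial. [folklore] -/
theorem valuation_monomial_lt_of_valuation_laurent_lt (hx : IsValueTranscendentalOver V K x)
    {r : LaurentPolynomial K} {γ : ValuationSubring.ValueGroup V}
    (h : V.valuation (LaurentPolynomial.eval₂ (algebraMap K Ω) x r) < γ) {i : ℤ}
    (hi : i ∈ r.coeff.support) :
    V.valuation (((r.coeff i : K) : Ω) * (x : Ω) ^ i) < γ :=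
  lt_of_le_of_lt (valuation_monomial_le_valuation_laurent hx hi) h

/-! ### Lemma 4.4: the geometric-series step and density of `R` in `K(x)` -/

/-- **Kuhlmann 2010, Lemma 4.4 (the inversion step)**: for `0 ≠ φ ∈ R = K[x,x⁻¹]` the inverse
`1/φ(x)` is approximated by elements of `R` to arbitrary order, `(K(x), v)` being of rank one:
with `vφ(x) = vc_kx^k`, `ψ = 1 - c_k⁻¹x⁻ᵏφ(x) ∈ R` has `vψ > 0` and
`φ̃ = c_k⁻¹x⁻ᵏ ∑_{i=0}^{n} ψⁱ ∈ R` has `v(1/φ - φ̃) = (n+1)vψ - vc_kx^k`, which exceeds any given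
value for `n` large. PROVED. [cite: Kuhlmann2010, Lemma 4.4] -/
theorem exists_laurent_valuation_inv_sub_lt (hx : IsValueTranscendentalOver V K x)
    (hr1 : IsRankOneValued V (IntermediateField.adjoin K ({(x : Ω)} : Set Ω)).toSubfield)
    {φ : LaurentPolynomial K} (hφ : φ ≠ 0) {d : Ω}
    (hd : d ∈ (IntermediateField.adjoin K ({(x : Ω)} : Set Ω)).toSubfield) (hd0 : d ≠ 0) :
    ∃ s : LaurentPolynomial K,
      V.valuation ((LaurentPolynomial.eval₂ (algebraMap K Ω) x φ)⁻¹ -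
        LaurentPolynomial.eval₂ (algebraMap K Ω) x s) < V.valuation d := by
  classical
  set Kx := (IntermediateField.adjoin K ({(x : Ω)} : Set Ω)).toSubfield with hKx
  set ev := LaurentPolynomial.eval₂ (algebraMap K Ω) x with hev
  -- the leading monomial `m = c x^k`
  obtain ⟨k, hk, hval, hle⟩ := exists_valuation_laurent_eq hx hφ
  set c : K := φ.coeff k with hc
  have hc0 : (c : Ω) ≠ 0 := fun h0 => (Finsupp.mem_support_iff.mp hk) (Subtype.ext h0)
  have hcK0 : c ≠ 0 := fun h0 => hc0 (by rw [h0]; rfl)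
  set m : Ω := (c : Ω) * (x : Ω) ^ k with hm
  have hm0 : m ≠ 0 := mul_ne_zero hc0 (zpow_ne_zero _ x.ne_zero)
  have hvm : V.valuation m ≠ 0 := (map_ne_zero _).mpr hm0
  -- `M = C c * T k`, `Minv = C c⁻¹ * T (-k)` evaluate to `m`, `m⁻¹`
  have hevM : ev (C c * T k) = m := by
    rw [hev, eval₂_C_mul_T, Units.val_zpow_eq_zpow_val]
    rfl
  have hevMinv : ev (C c⁻¹ * T (-k)) = m⁻¹ := by
    rw [hev, eval₂_C_mul_T, Units.val_zpow_eq_zpow_val, hm, mul_inv, zpow_neg, map_inv₀]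
    rfl
  -- `ψ = 1 - m⁻¹ φ(x)` has `|ψ| < 1`
  set Ψ : LaurentPolynomial K := 1 - C c⁻¹ * T (-k) * φ with hΨ
  have hevΨ : ev Ψ = 1 - m⁻¹ * ev φ := by
    rw [hΨ, map_sub, map_one, map_mul, hevMinv]
  have hψ : V.valuation (ev Ψ) < 1 := by
    -- `1 - m⁻¹ φ = -m⁻¹ (φ - M)`, and every monomial of `φ - M` has value `< |m|`
    have hdiff : V.valuation (ev (φ - C c * T k)) < V.valuation m := by
      refine valuation_laurent_lt hvm fun i hi => ?_
      have hcoeff : (φ - C c * T k).coeff i = φ.coeff i - Finsupp.single k c i := by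
        rw [AddMonoidAlgebra.coeff_sub, ← LaurentPolynomial.single_eq_C_mul_T,
          AddMonoidAlgebra.coeff_single, Finsupp.sub_apply]
      have hik : i ≠ k := by
        intro hik
        have h0 : (φ - C c * T k).coeff i = 0 := by
          rw [hcoeff, hik, Finsupp.single_eq_same, hc, sub_self]
        exact (Finsupp.mem_support_iff.mp hi) h0
      have hci : (φ - C c * T k).coeff i = φ.coeff i := by
        rw [hcoeff, Finsupp.single_eq_of_ne hik, sub_zero]
      have hiφ : i ∈ φ.coeff.support := by
        rw [Finsupp.mem_support_iff, ← hci]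
        exact Finsupp.mem_support_iff.mp hi
      rw [hci]
      refine lt_of_le_of_ne (hle i hiφ) ?_
      have hi0 : ((φ.coeff i : K) : Ω) ≠ 0 := fun h0 =>
        (Finsupp.mem_support_iff.mp hiφ) (Subtype.ext h0)
      exact hx.valuation_mul_zpow_ne (φ.coeff i).2 c.2 hi0 hik
    have heq : ev Ψ = -(m⁻¹ * ev (φ - C c * T k)) := by
      rw [hevΨ, map_sub, hevM, mul_sub, inv_mul_cancel₀ hm0]
      ring
    rw [heq, Valuation.map_neg, map_mul, map_inv₀]
    have hvm' : 0 < (V.valuation m)⁻¹ := zero_lt_iff.mpr (inv_ne_zero hvm)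
    calc (V.valuation m)⁻¹ * V.valuation (ev (φ - C c * T k))
        < (V.valuation m)⁻¹ * V.valuation m := by gcongr
      _ = 1 := inv_mul_cancel₀ hvm
  -- memberships in `K(x)`
  have hmem : ∀ r : LaurentPolynomial K, ev r ∈ Kx := fun r => laurent_eval₂_mem_adjoin x r
  have hmKx : m ∈ Kx := by rw [← hevM]; exact hmem _
  -- choose `N` with `|m|⁻¹ |ψ|^N < |d|`
  obtain ⟨N, hN⟩ := hr1.exists_forall_mul_pow_lt (hmem Ψ) hψ (Kx.inv_mem hmKx) hd hd0
  -- `s = Minv * ∑_{i<N} Ψ^i`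
  refine ⟨C c⁻¹ * T (-k) * ∑ i ∈ Finset.range N, Ψ ^ i, ?_⟩
  have hφfac : ev φ = m * (1 - ev Ψ) := by
    rw [hevΨ, sub_sub_cancel, mul_inv_cancel_left₀ hm0]
  have h1ψ : 1 - ev Ψ ≠ 0 := by
    intro h0
    have : V.valuation (ev Ψ) = 1 := by
      rw [sub_eq_zero] at h0
      rw [← h0, map_one]
    exact hψ.ne this
  have hv1ψ : V.valuation (1 - ev Ψ) = 1 := by
    rw [Valuation.map_one_sub_of_lt _ hψ]
  have hgeom : (1 - ev Ψ) * ∑ i ∈ Finset.range N, ev Ψ ^ i = 1 - ev Ψ ^ N :=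
    mul_neg_geom_sum (ev Ψ) N
  have hkey : (ev φ)⁻¹ - ev (C c⁻¹ * T (-k) * ∑ i ∈ Finset.range N, Ψ ^ i) =
      m⁻¹ * (ev Ψ ^ N / (1 - ev Ψ)) := by
    rw [map_mul, hevMinv, map_sum, hφfac]
    simp_rw [map_pow]
    rw [mul_inv, ← mul_sub]
    congr 1
    rw [eq_div_iff h1ψ, sub_mul, inv_mul_cancel₀ h1ψ, mul_comm (∑ i ∈ Finset.range N, ev Ψ ^ i),
      hgeom]
    ring
  rw [hkey, map_mul, map_div₀, hv1ψ, div_one, map_inv₀, map_pow]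
  have := hN N le_rfl
  rwa [map_inv₀] at this

/-- **Kuhlmann 2010, Lemma 4.4 (first half): `R = K[x,x⁻¹]` is dense in its quotient field
`K(x)`** when `x` is value-transcendental over `K` and `(K(x), v)` has rank one: every
`a ∈ K(x)` is approximated by finite Laurent series to arbitrary order (`a = f(x)/g(x)`;
approximate `1/g(x)` by `exists_laurent_valuation_inv_sub_lt` and multiply by `f(x)`). PROVED.
[cite: Kuhlmann2010, Lemma 4.4] -/
theorem exists_laurent_valuation_sub_lt_of_mem_adjoin (hx : IsValueTranscendentalOver V K x)
    (hr1 : IsRankOneValued V (IntermediateField.adjoin K ({(x : Ω)} : Set Ω)).toSubfield)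
    {a : Ω} (ha : a ∈ (IntermediateField.adjoin K ({(x : Ω)} : Set Ω)).toSubfield) {d : Ω}
    (hd : d ∈ (IntermediateField.adjoin K ({(x : Ω)} : Set Ω)).toSubfield) (hd0 : d ≠ 0) :
    ∃ s : LaurentPolynomial K,
      V.valuation (a - LaurentPolynomial.eval₂ (algebraMap K Ω) x s) < V.valuation d := by
  classical
  set Kx := (IntermediateField.adjoin K ({(x : Ω)} : Set Ω)).toSubfield with hKx
  set ev := LaurentPolynomial.eval₂ (algebraMap K Ω) x with hev
  have hdv : 0 < V.valuation d := (Valuation.pos_iff _).mpr hd0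
  obtain ⟨f, g, hafg⟩ := (IntermediateField.mem_adjoin_simple_iff K _).mp
    (show a ∈ IntermediateField.adjoin K ({(x : Ω)} : Set Ω) from ha)
  -- `f(x) = ev (toLaurent f)`, `g(x) = ev (toLaurent g)`
  have hevf : ev (Polynomial.toLaurent f) = Polynomial.aeval (x : Ω) f := by
    rw [hev, eval₂_toLaurent, Polynomial.aeval_def]
  have hevg : ev (Polynomial.toLaurent g) = Polynomial.aeval (x : Ω) g := by
    rw [hev, eval₂_toLaurent, Polynomial.aeval_def]
  by_cases hg : Polynomial.aeval (x : Ω) g = 0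
  · refine ⟨0, ?_⟩
    rw [hafg, hg, div_zero, map_zero, sub_zero, map_zero]
    exact hdv
  by_cases hf : Polynomial.aeval (x : Ω) f = 0
  · refine ⟨0, ?_⟩
    rw [hafg, hf, zero_div, map_zero, sub_zero, map_zero]
    exact hdv
  have hG : Polynomial.toLaurent g ≠ 0 := fun h0 => hg (by rw [← hevg, h0, map_zero])
  have hfKx : Polynomial.aeval (x : Ω) f ∈ Kx := by rw [← hevf]; exact laurent_eval₂_mem_adjoin x _
  -- approximate `1/g(x)` to order `|d / f(x)|`
  obtain ⟨s, hs⟩ := exists_laurent_valuation_inv_sub_lt hx hr1 hG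
    (div_mem hd hfKx) (div_ne_zero hd0 hf)
  refine ⟨Polynomial.toLaurent f * s, ?_⟩
  have heq : a - ev (Polynomial.toLaurent f * s) =
      Polynomial.aeval (x : Ω) f * ((ev (Polynomial.toLaurent g))⁻¹ - ev s) := by
    rw [hafg, map_mul, hevf, hevg]
    ring
  rw [heq, map_mul]
  have hvf : 0 < V.valuation (Polynomial.aeval (x : Ω) f) := (Valuation.pos_iff _).mpr hf
  calc V.valuation (Polynomial.aeval (x : Ω) f) *
        V.valuation ((ev (Polynomial.toLaurent g))⁻¹ - ev s)
      < V.valuation (Polynomial.aeval (x : Ω) f) * V.valuation (d / Polynomial.aeval (x : Ω) f) := by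
        gcongr
    _ = V.valuation d := by rw [map_div₀, mul_div_cancel₀ _ hvf.ne']

end Laurent

/-! ### `K(x)^h`: values, residues, and Lemma 4.4 -/

section HenselizedAdjoin

variable {V} [IsAlgClosed Ω] {K : Subfield Ω}

/-- **`vK(x)^h = vK ⊕ ℤvx`** (Kuhlmann 2010, §4, (4.2): "In this case, `F̄ = K̄` and
`vF = vK ⊕ ℤvx`"; from Lemma 2.2 — the henselization is immediate — and Lemma 2.5): every
non-zero element of `K(x)^h` has the value of some `c x^m`, `c ∈ K`, `m ∈ ℤ`. PROVED
(`Kuhlmann2010HenselizationImmediate_holds`, `exists_valuation_eq_of_mem_adjoin`).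
[cite: Kuhlmann2010, Section 4, (4.2)] -/
theorem exists_valuation_eq_of_mem_henselizedAdjoin {x : Ω} (hx : IsValueTranscendentalOver V K x)
    {a : Ω} (ha : a ∈ henselizedAdjoin V K x) (ha0 : a ≠ 0) :
    ∃ c ∈ K, ∃ m : ℤ, V.valuation a = V.valuation c * V.valuation x ^ m := by
  obtain ⟨hv, -⟩ := Kuhlmann2010HenselizationImmediate_holds Ω V
    (IntermediateField.adjoin K ({x} : Set Ω)).toSubfield
  obtain ⟨b, hb, hab⟩ := hv a ha ha0
  have hb0 : b ≠ 0 := by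
    rintro rfl
    rw [map_zero, map_eq_zero] at hab
    exact ha0 hab
  obtain ⟨c, hc, m, hbc⟩ := exists_valuation_eq_of_mem_adjoin hx hb hb0
  exact ⟨c, hc, m, hab.trans hbc⟩

/-- **`K(x)^h v = Kv`** (Kuhlmann 2010, §4, (4.2): "`F̄ = K̄`"; Lemma 2.2 and Lemma 2.5): the
residues of `V ∩ K(x)^h` are residues of `K`. PROVED. [cite: Kuhlmann2010, Section 4, (4.2)] -/
theorem resField_henselizedAdjoin_le {x : Ω} (hx : IsValueTranscendentalOver V K x) :
    resField V (henselizedAdjoin V K x) ≤ resField V K := by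
  obtain ⟨-, hres⟩ := Kuhlmann2010HenselizationImmediate_holds Ω V
    (IntermediateField.adjoin K ({x} : Set Ω)).toSubfield
  exact hres.trans (resField_adjoin_le hx)

/-- A unit of `K(x)^h` is congruent to an element of `K`: for `a ∈ K(x)^h` with `|a| = 1` there
is `c ∈ K` with `|c| = 1` and `|a - c| < 1` (`F̄ = K̄`). [cite: Kuhlmann2010, Section 4, (4.2)] -/
theorem exists_mem_valuation_sub_lt_one_of_mem_henselizedAdjoin {x : Ω}
    (hx : IsValueTranscendentalOver V K x) {a : Ω} (ha : a ∈ henselizedAdjoin V K x)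
    (ha1 : V.valuation a = 1) : ∃ c ∈ K, V.valuation c = 1 ∧ V.valuation (a - c) < 1 := by
  have haV : a ∈ V := (V.valuation_le_one_iff a).mp ha1.le
  have hres : residue V ⟨a, haV⟩ ∈ resField V K :=
    resField_henselizedAdjoin_le hx (residue_mem_resField V ⟨a, haV⟩ ha)
  obtain ⟨c, hcK, hc1, hlt⟩ := exists_mem_valuation_div_sub_one_lt V ha1 hres
  refine ⟨c, hcK, hc1, ?_⟩
  have hc0 : c ≠ 0 := fun h => by rw [h, map_zero] at hc1; exact zero_ne_one hc1
  have : a - c = c * (a / c - 1) := by field_simp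
  rw [this, map_mul, hc1, one_mul]
  exact hlt

/-- **Kuhlmann 2010, Lemma 4.4: `R = K[x,x⁻¹]` is dense in `F = K(x)^h`** for `x`
value-transcendental over `K` and `F` of rank one: every `a ∈ K(x)^h` is approximated by finite
Laurent series `∑ cᵢxⁱ` (`cᵢ ∈ K`) to any order `|d|`, `0 ≠ d ∈ K(x)`. PROVED from Lemma 2.4
(`exists_mem_valuation_sub_lt_of_mem_henselization_of_archimedean`: `K(x)` is dense in `K(x)^h`,
the valuation being archimedean on the algebraic closure of the rank-one `K(x)`) and the density
of `R` in `K(x)` (`exists_laurent_valuation_sub_lt_of_mem_adjoin`). [cite: Kuhlmann2010, Lemma 4.4] -/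
theorem exists_laurent_valuation_sub_lt {x : Ωˣ} (hx : IsValueTranscendentalOver V K x)
    (hr1 : IsRankOneValued V (henselizedAdjoin V K x)) {a : Ω} (ha : a ∈ henselizedAdjoin V K x)
    {d : Ω} (hd : d ∈ (IntermediateField.adjoin K ({(x : Ω)} : Set Ω)).toSubfield) (hd0 : d ≠ 0) :
    ∃ s : LaurentPolynomial K,
      V.valuation (a - LaurentPolynomial.eval₂ (algebraMap K Ω) x s) < V.valuation d := by
  set Kx := (IntermediateField.adjoin K ({(x : Ω)} : Set Ω)).toSubfield with hKx
  have hxKx : (x : Ω) ∈ Kx := IntermediateField.subset_adjoin K ({(x : Ω)} : Set Ω) rfl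
  -- `K(x)` has rank one
  have hr1' : IsRankOneValued V Kx :=
    hr1.of_le_of_isValueTranscendentalOver (adjoin_le_henselizedAdjoin V K x) hx hxKx
  -- the valuation is archimedean on the algebraic closure of `K(x)`, and non-trivial on `K(x)`
  have harch : ∀ y z : Ω, IsAlgebraic Kx y → IsAlgebraic Kx z → 1 < V.valuation y →
      ∃ n : ℕ, V.valuation z ≤ V.valuation y ^ n := fun y z hy hz h1 =>
    hr1'.archimedean_of_isAlgebraic hy hz h1
  have hπ : ∃ π ∈ Kx, π ≠ 0 ∧ V.valuation π < 1 := by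
    rcases hx.one_lt_or_one_lt_inv with h1 | h1
    · refine ⟨(x : Ω)⁻¹, Kx.inv_mem hxKx, inv_ne_zero x.ne_zero, ?_⟩
      rw [map_inv₀]
      exact inv_lt_one_of_one_lt₀ h1
    · refine ⟨(x : Ω), hxKx, x.ne_zero, ?_⟩
      rw [map_inv₀] at h1
      have := inv_lt_one_of_one_lt₀ h1
      rwa [inv_inv] at this
  have hdalg : IsAlgebraic Kx d := isAlgebraic_algebraMap (⟨d, hd⟩ : Kx)
  -- Lemma 2.4: `b ∈ K(x)` close to `a`; then Lemma 4.4 in `K(x)`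
  obtain ⟨b, hb, hab⟩ :=
    exists_mem_valuation_sub_lt_of_mem_henselization_of_archimedean V Kx harch hπ ha hdalg hd0
  obtain ⟨s, hs⟩ := exists_laurent_valuation_sub_lt_of_mem_adjoin hx hr1' hb hd hd0
  refine ⟨s, ?_⟩
  have : a - LaurentPolynomial.eval₂ (algebraMap K Ω) x s =
      (a - b) + (b - LaurentPolynomial.eval₂ (algebraMap K Ω) x s) := by ring
  rw [this]
  exact lt_of_le_of_lt (Valuation.map_add _ _ _) (max_lt hab hs)

end HenselizedAdjoin

end Literature.AlgebraicGeometry.Resolution
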